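import Summits.HodgeConjecture.CorCM.IrreducibleOddWeightsOrbitBalanceConverse
import HarnessLib

/-!
# Two CM fields over a common ABELIAN pivot `M` whose odd weights are IRREDUCIBLE (imaginary quadratic, cyclic quartic, …),
# Galois closures meeting inside `M`: `Hg(A₀ × A₁) = Hg(A₀) × Hg(A₁)` iff ONE of the two types is equidistributed over `M`

COR-CM (cell `pub-hodgecm2`, binder seat `b16` gen 62, count-neutral claim ORBIT BALANCE, file O10 — CM fields and
realisations; theorems only, no definition, no named fact, no `sorry`).  NEW as stated, hence under `Summits/`.  HONEST
FRAMING: unconditional statements about `dim MT(A₀ × A₁)` and about which Hodge classes on `A₀^a × A₁^b` are sums of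
products; no Hodge class is claimed algebraic; `HC_CM` is neither used nor asserted.

SETTING.  Two-slot family `{i₀, i₁}`; a number field `M`, ABELIAN Galois over `ℚ`, embedded in both CM fields
(`j₀ : M → K_{i₀}`, `j₁ : M → K_{i₁}`), `z₀ : M → ℂ`; the Galois closures meet INSIDE `z₀(M)`; and the ODD WEIGHTS
`Anti(M) = {f : Hom(M,ℂ) → ℚ | f(z̄) = −f(z)}` have no proper non-zero `Aut(ℂ)`-stable subspace (IRREDUCIBLE; automatic for
`M` imaginary quadratic — `dim Anti = 1` — and true e.g. for cyclic quartic CM fields).  SHADOWS `w_κ(z) = 2·#{t ∈ Φ_{i_κ} |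
t ∘ j_κ = z} − [K_{i_κ} : M]`; `Φ_{i_κ}` EQUIDISTRIBUTED over `M` iff `w_κ = 0`.

* **`cmFamilyRank_add_card_eq_pair_iff_of_irreducible_anti`** — `Hg(A₀ × A₁) = Hg(A₀) × Hg(A₁)` **iff `Φ_{i₀}` or `Φ_{i₁}`
  is equidistributed over `M`**.  (⟸) file O3 `cmFamilyRank_add_card_eq_of_pairwise_pivot`; (⟹) if both shadows are
  non-zero: `w₁` generates the irreducible `Anti(M) ∋ w₀` under `Aut(ℂ)`, so `w₀ = S(w₁)` with `S = Σ_k c_k π(g_k)`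
  EQUIVARIANT (the action on `Hom(M, ℂ)` is abelian), and the collision lemma of file O7 applies to
  `T₀ = (res₀)_*`, `T₁ = S ∘ (res₁)_*` (`T₀ u₀ = w₀ = T₁ u₁ ≠ 0`): `shadow_eq_zero_or_of_cmFamilyRank_add_card_eq`.
* **`forall_hodgeClassesProductSpan_pair_iff_of_irreducible_anti`** — realisations: every Hodge class on every `A₀^a × A₁^b`
  (disjoint slot maps) is a sum of exterior products **iff** one type is equidistributed over `M`;
  `exists_not_hodgeClassesProductSpan_pair_of_shadows_ne_zero` (both shadows non-zero ⟹ a MIXED exceptional class).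
File O8 is the case `M = k` imaginary quadratic (there via the tree's Weil-type obstruction); here `M` may be any abelian
CM field with irreducible odd part, and the proof is uniform (pivot + collision).

## References

* [Kubota1965] T. Kubota, *On the field extension by complex multiplication*, Trans. AMS 118 (1965), §4 Lemma 2.
* [Gordon1999HodgeAVSurvey] B. B. Gordon, *A survey of the Hodge conjecture for abelian varieties*, §3 Theorem (proof),
  7.5–7.7, 9.4.3.
* [MoonenZarhin1999LowDim] B. Moonen, Yu. Zarhin, Math. Ann. 315 (1999), Thm. (0.1) (a), §3 (3.1).
* [Deligne1982HodgeCycles] P. Deligne, *Hodge cycles on abelian varieties*, LNM 900 (1982), I Ex. 3.7, §4.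
* [Shimura1998] G. Shimura, *Abelian Varieties with Complex Multiplication and Modular Functions*, §8.1, §18.2.
-/

set_option autoImplicit false

noncomputable section

open scoped BigOperators Classical

open CategoryTheory CategoryTheory.Limits NumberField Module IntermediateField

namespace Summit.HodgeConjecture.CorCM

open Literature.NumberTheory.ComplexMultiplication
open Literature.AlgebraicGeometry.Motives (AbelianVariety CMType)
open Literature.AlgebraicGeometry.Motives.AbelianVariety
open Literature.AlgebraicGeometry.HodgeTheory
open Literature.AlgebraicGeometry.ComplexMultiplication (IsCMTypeRealisation)
open Literature.AlgebraicGeometry.Pohlmann1968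

variable {I : Type} [Fintype I] {K : I → Type} [∀ i, Field (K i)] [∀ i, NumberField (K i)] [∀ i, IsCMField (K i)]
  {M : Type} [Field M] [NumberField M]

/-! ### §1 The push-forward (shadow) along a subfield -/

omit [Fintype I] [∀ i, IsCMField (K i)] [NumberField M] in
/-- Translating a weight by `g` before pushing it forward along `j : M → K` is pushing forward and translating by `g`.
[cite: Shimura1998, §8.1] -/
theorem sum_filter_comp_eq_smul {i : I} (j : M →+* K i) (g : ℂ ≃+* ℂ) (f : (K i →+* ℂ) → ℚ) (z : M →+* ℂ) :
    ∑ t ∈ Finset.univ.filter (fun t : K i →+* ℂ => t.comp j = g • z), f t =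
      ∑ t ∈ Finset.univ.filter (fun t : K i →+* ℂ => t.comp j = z), f (g • t) := by
  rw [Finset.sum_filter, Finset.sum_filter]
  refine (Fintype.sum_equiv (MulAction.toPerm g) _ _ fun t => ?_).symm
  have hiff : t.comp j = z ↔ (g • t).comp j = g • z := by
    constructor
    · intro ht
      rw [← ht]
      exact RingHom.ext fun m => rfl
    · intro ht
      have h2 : g⁻¹ • ((g • t).comp j) = g⁻¹ • (g • z) := by rw [ht]
      rw [inv_smul_smul] at h2
      rw [← h2]
      exact RingHom.ext fun m => (g.symm_apply_apply (t (j m))).symm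
  simp only [MulAction.toPerm_apply, hiff]

omit [Fintype I] [NumberField M] in
/-- **The shadow of a CM type on a subfield is an ODD weight.** [cite: Gordon1999HodgeAVSurvey, 9.4.3] [cite: Shimura1998, §18.2] -/
theorem shadow_mem_antiWeights {i : I} (j : M →+* K i) (Φ : CMType (K i)) :
    (fun z : M →+* ℂ => ∑ t ∈ Finset.univ.filter (fun t : K i →+* ℂ => t.comp j = z), antiVec Φ.1 (1 : ℂ ≃+* ℂ) t) ∈
      antiWeights (E := M →+* ℂ) (starRingAut : ℂ ≃+* ℂ) := by
  rw [mem_antiWeights_iff']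
  intro z
  rw [sum_filter_comp_eq_smul, ← Finset.sum_neg_distrib]
  refine Finset.sum_congr rfl fun t _ => ?_
  exact mem_antiWeights_iff'.1 (antiVec_mem_antiWeights (isCMTypeWith_conj Φ) (1 : ℂ ≃+* ℂ)) t

omit [Fintype I] [∀ i, IsCMField (K i)] [NumberField M] in
/-- The shadow vanishes at `z` iff `Φ` is equidistributed over the fibre of `z`. [cite: Gordon1999HodgeAVSurvey, 9.4.3] -/
theorem shadow_apply_eq_zero_iff {i : I} (j : M →+* K i) (Φ : CMType (K i)) (z : M →+* ℂ) :
    ∑ t ∈ Finset.univ.filter (fun t : K i →+* ℂ => t.comp j = z), antiVec Φ.1 (1 : ℂ ≃+* ℂ) t = 0 ↔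
      2 * (Finset.univ.filter fun t : K i →+* ℂ => t.comp j = z ∧ t ∈ Φ.1).card =
        (Finset.univ.filter fun t : K i →+* ℂ => t.comp j = z).card := by
  have h1 : ∑ t ∈ Finset.univ.filter (fun t : K i →+* ℂ => t.comp j = z), antiVec Φ.1 (1 : ℂ ≃+* ℂ) t =
      2 * ((Finset.univ.filter fun t : K i →+* ℂ => t.comp j = z ∧ t ∈ Φ.1).card : ℚ) -
        ((Finset.univ.filter fun t : K i →+* ℂ => t.comp j = z).card : ℚ) := by
    simp only [antiVec, translateInd, one_smul, Finset.sum_sub_distrib, Finset.sum_const, nsmul_eq_mul, mul_one,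
      ← Finset.mul_sum, Finset.sum_boole, Finset.filter_filter]
  rw [h1, sub_eq_zero]
  exact_mod_cast Iff.rfl

/-! ### §2 The rank criterion -/

section Rank

/-- **BOTH SHADOWS NON-ZERO OVER AN ABELIAN PIVOT WITH IRREDUCIBLE ODD PART ⟹ NOT ADDITIVE.**  `M` abelian Galois,
`j₀ : M → K_{i₀}`, `j₁ : M → K_{i₁}` (`i₀ ≠ i₁`), `Anti(M)` with no proper non-zero `Aut(ℂ)`-stable subspace.  If neither
`Φ_{i₀}` nor `Φ_{i₁}` is equidistributed over `M`, then `cmFamilyRank Φ + |I| < Σ_i cmTypeRank Φ_i + 1`.  (`w₁` generates the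
irreducible `Anti ∋ w₀`: `w₀ = S w₁` with `S = Σ_k c_k π(g_k)` equivariant by commutativity; collision `T₀ = (res₀)_*`,
`T₁ = S ∘ (res₁)_*`.) [cite: Kubota1965, §4 Lemma 2] [cite: Gordon1999HodgeAVSurvey, §3 Theorem (proof) and 7.5] -/
theorem cmFamilyRank_add_card_lt_of_shadows_ne_zero_of_irreducible_anti [IsAbelianGalois ℚ M] {i₀ i₁ : I} (h01 : i₀ ≠ i₁)
    (Φ : ∀ i, CMType (K i)) (j₀ : M →+* K i₀) (j₁ : M →+* K i₁)
    (hirr : ∀ W : Submodule ℚ ((M →+* ℂ) → ℚ), W ≤ antiWeights (E := M →+* ℂ) (starRingAut : ℂ ≃+* ℂ) → W ≠ ⊥ →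
      (∀ (g : ℂ ≃+* ℂ) (f : (M →+* ℂ) → ℚ), f ∈ W → (fun z => f (g • z)) ∈ W) →
      W = antiWeights (E := M →+* ℂ) (starRingAut : ℂ ≃+* ℂ))
    (h₀ : ∃ z : M →+* ℂ, 2 * (Finset.univ.filter fun t : K i₀ →+* ℂ => t.comp j₀ = z ∧ t ∈ (Φ i₀).1).card ≠
      (Finset.univ.filter fun t : K i₀ →+* ℂ => t.comp j₀ = z).card)
    (h₁ : ∃ z : M →+* ℂ, 2 * (Finset.univ.filter fun t : K i₁ →+* ℂ => t.comp j₁ = z ∧ t ∈ (Φ i₁).1).card ≠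
      (Finset.univ.filter fun t : K i₁ →+* ℂ => t.comp j₁ = z).card) :
    CMAlgebra.cmFamilyRank Φ + Fintype.card I < (∑ i, cmTypeRank (Φ i)) + 1 := by
  haveI : Nonempty I := ⟨i₀⟩
  haveI : ∀ i, Nonempty (K i →+* ℂ) := fun i => inferInstance
  -- notation
  let G := ℂ ≃+* ℂ
  let V := (M →+* ℂ) → ℚ
  let π : G → V → V := fun g f y => f (g⁻¹ • y)
  let u : ∀ i, (K i →+* ℂ) → ℚ := fun i => antiVec (Φ i).1 (1 : G)
  -- the push-forwards `(res_κ)_*`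
  let R : ∀ {i : I} (j : M →+* K i), ((K i →+* ℂ) → ℚ) →ₗ[ℚ] V := fun {i} j =>
    { toFun := fun f y => ∑ t ∈ Finset.univ.filter (fun t : K i →+* ℂ => t.comp j = y), f t
      map_add' := fun f f' => by
        funext y
        simp only [Pi.add_apply]
        exact Finset.sum_add_distrib
      map_smul' := fun c f => by
        funext y
        change ∑ x ∈ Finset.univ.filter (fun t : K i →+* ℂ => t.comp j = y), c * f x =
          c * ∑ t ∈ Finset.univ.filter (fun t : K i →+* ℂ => t.comp j = y), f t
        rw [Finset.mul_sum] }
  have hR : ∀ {i : I} (j : M →+* K i) (g : G) (f : (K i →+* ℂ) → ℚ),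
      R j (fun x => f (g⁻¹ • x)) = π g (R j f) := fun {i} j g f => by
    funext y
    exact (sum_filter_comp_eq_smul j g⁻¹ f y).symm
  -- the shadows
  set w₀ : V := R j₀ (u i₀) with hw₀
  set w₁ : V := R j₁ (u i₁) with hw₁
  have hw₀ne : w₀ ≠ 0 := by
    obtain ⟨z, hz⟩ := h₀
    intro h0
    exact hz ((shadow_apply_eq_zero_iff j₀ (Φ i₀) z).1 (by have := congrFun h0 z; exact this))
  have hw₁ne : w₁ ≠ 0 := by
    obtain ⟨z, hz⟩ := h₁
    intro h0
    exact hz ((shadow_apply_eq_zero_iff j₁ (Φ i₁) z).1 (by have := congrFun h0 z; exact this))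
  have hw₀odd : w₀ ∈ antiWeights (E := M →+* ℂ) (starRingAut : ℂ ≃+* ℂ) := shadow_mem_antiWeights j₀ (Φ i₀)
  have hw₁odd : w₁ ∈ antiWeights (E := M →+* ℂ) (starRingAut : ℂ ≃+* ℂ) := shadow_mem_antiWeights j₁ (Φ i₁)
  -- the action on `Hom(M, ℂ)` is abelian, and commutes with conjugation
  have hcomm : ∀ (g g' : G) (y : M →+* ℂ), g • g' • y = g' • g • y := fun g g' y => by
    refine RingHom.ext fun m => ?_
    change g (g' (y m)) = g' (g (y m))
    exact ringEquiv_comm_apply_of_abelian y g g' (y m)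
      ((y.toRatAlgHom.fieldRange_le_normalClosure : y.toRatAlgHom.fieldRange ≤ normalClosure ℚ M ℂ) ⟨m, rfl⟩)
  -- `W = span{translates of w₁}` is a non-zero stable subspace of `Anti`, hence all of `Anti ∋ w₀`
  let W : Submodule ℚ V := Submodule.span ℚ (Set.range fun g : G => fun y => w₁ (g • y))
  have hWle : W ≤ antiWeights (E := M →+* ℂ) (starRingAut : ℂ ≃+* ℂ) := by
    refine Submodule.span_le.2 ?_
    rintro _ ⟨g, rfl⟩
    rw [SetLike.mem_coe, mem_antiWeights_iff']
    intro y
    change w₁ (g • (starRingAut : G) • y) = -w₁ (g • y)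
    rw [hcomm]
    exact mem_antiWeights_iff'.1 hw₁odd (g • y)
  have hWne : W ≠ ⊥ := by
    intro hW
    apply hw₁ne
    have hmem : (fun y => w₁ ((1 : G) • y)) ∈ W := Submodule.subset_span ⟨1, rfl⟩
    rw [hW, Submodule.mem_bot] at hmem
    simpa only [one_smul] using hmem
  have hWst : ∀ (g : G) (f : V), f ∈ W → (fun z => f (g • z)) ∈ W := by
    intro g f hf
    induction hf using Submodule.span_induction with
    | mem f hf =>
      obtain ⟨g', rfl⟩ := hf
      refine Submodule.subset_span ⟨g' * g, ?_⟩
      funext y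
      change w₁ ((g' * g) • y) = w₁ (g' • g • y)
      rw [mul_smul]
    | zero => exact W.zero_mem
    | add f f' _ _ hf hf' => exact W.add_mem hf hf'
    | smul c f _ hf => exact W.smul_mem c hf
  have hw₀W : w₀ ∈ W := by
    rw [hirr W hWle hWne hWst]
    exact hw₀odd
  -- every element of `W` is `S w₁` for an equivariant `S`
  have hS : ∀ v ∈ W, ∃ S : V →ₗ[ℚ] V, (∀ (g : G) (f : V), S (fun x => f (g⁻¹ • x)) = π g (S f)) ∧ S w₁ = v := by
    intro v hv
    induction hv using Submodule.span_induction with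
    | mem v hv =>
      obtain ⟨g, rfl⟩ := hv
      refine ⟨LinearMap.funLeft ℚ ℚ fun y : M →+* ℂ => g • y, fun g' f => ?_, rfl⟩
      funext y
      change f (g'⁻¹ • g • y) = f (g • g'⁻¹ • y)
      rw [hcomm]
    | zero => exact ⟨0, fun g f => by funext y; rfl, by simp⟩
    | add v v' _ _ hv hv' =>
      obtain ⟨S, hS, hSw⟩ := hv
      obtain ⟨S', hS', hSw'⟩ := hv'
      refine ⟨S + S', fun g f => ?_, by simp [hSw, hSw']⟩
      rw [LinearMap.add_apply, LinearMap.add_apply, hS g f, hS' g f]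
      funext y
      rfl
    | smul c v _ hv =>
      obtain ⟨S, hS, hSw⟩ := hv
      refine ⟨c • S, fun g f => ?_, by simp [hSw]⟩
      rw [LinearMap.smul_apply, LinearMap.smul_apply, hS g f]
      funext y
      rfl
  obtain ⟨S, hSeq, hSw⟩ := hS w₀ hw₀W
  -- collision: `T₀ = (res₀)_*`, `T₁ = S ∘ (res₁)_*`
  refine IrrOdd.typeRank_sigmaType_add_card_lt_of_eval_eq (G := G) (Φ := fun i => (Φ i).1)
    (fun i => isCMTypeWith_conj (Φ i)) h01 π (R j₀) (S ∘ₗ R j₁) (fun g f => hR j₀ g f) (fun g f => ?_) ?_ hw₀ne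
  · rw [LinearMap.comp_apply, LinearMap.comp_apply, hR j₁ g f, hSeq]
  · rw [LinearMap.comp_apply]
    exact hSw.symm

/-- **THE EXACT CRITERION over an abelian pivot with irreducible odd part.**  Two-slot family; `M` abelian Galois with
`Anti(M)` irreducible (e.g. `M` imaginary quadratic, cyclic quartic CM), `j_κ : M → K_{i_κ}`, Galois closures meeting inside
`z₀(M)`.  Then `Hg(A₀ × A₁) = Hg(A₀) × Hg(A₁)` **iff `Φ_{i₀}` or `Φ_{i₁}` is equidistributed over `M`**.
[cite: Kubota1965, §4 Lemma 2] [cite: Gordon1999HodgeAVSurvey, §3 Theorem (proof), 7.5–7.7 and 9.4.3] -/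
theorem cmFamilyRank_add_card_eq_pair_iff_of_irreducible_anti [IsAbelianGalois ℚ M] {i₀ i₁ : I} (h01 : i₀ ≠ i₁)
    (hI : ∀ l, l = i₀ ∨ l = i₁) (Φ : ∀ i, CMType (K i)) (j₀ : M →+* K i₀) (j₁ : M →+* K i₁) (z₀ : M →+* ℂ)
    (hmeet : ∀ z : ℂ, z ∈ normalClosure ℚ (K i₀) ℂ → z ∈ normalClosure ℚ (K i₁) ℂ → z ∈ Set.range z₀)
    (hirr : ∀ W : Submodule ℚ ((M →+* ℂ) → ℚ), W ≤ antiWeights (E := M →+* ℂ) (starRingAut : ℂ ≃+* ℂ) → W ≠ ⊥ →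
      (∀ (g : ℂ ≃+* ℂ) (f : (M →+* ℂ) → ℚ), f ∈ W → (fun z => f (g • z)) ∈ W) →
      W = antiWeights (E := M →+* ℂ) (starRingAut : ℂ ≃+* ℂ)) :
    CMAlgebra.cmFamilyRank Φ + Fintype.card I = (∑ i, cmTypeRank (Φ i)) + 1 ↔
      ((∀ z : M →+* ℂ, 2 * (Finset.univ.filter fun t : K i₀ →+* ℂ => t.comp j₀ = z ∧ t ∈ (Φ i₀).1).card =
          (Finset.univ.filter fun t : K i₀ →+* ℂ => t.comp j₀ = z).card) ∨
        ∀ z : M →+* ℂ, 2 * (Finset.univ.filter fun t : K i₁ →+* ℂ => t.comp j₁ = z ∧ t ∈ (Φ i₁).1).card =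
          (Finset.univ.filter fun t : K i₁ →+* ℂ => t.comp j₁ = z).card) := by
  haveI : Nonempty I := ⟨i₀⟩
  refine ⟨fun hadd => ?_, fun h => ?_⟩
  · by_contra hne
    push Not at hne
    exact absurd hadd (ne_of_lt (cmFamilyRank_add_card_lt_of_shadows_ne_zero_of_irreducible_anti h01 Φ j₀ j₁ hirr
      hne.1 hne.2))
  · refine cmFamilyRank_add_card_eq_of_pairwise_pivot Φ fun i i' hii' => ?_
    rcases hI i with rfl | rfl <;> rcases hI i' with rfl | rfl
    · exact absurd rfl hii'
    · rcases h with h | h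
      · exact Or.inl ⟨M, inferInstance, inferInstance, inferInstance, j₀, z₀, hmeet, h⟩
      · exact Or.inr ⟨M, inferInstance, inferInstance, inferInstance, j₁, z₀, fun z h₁ h₀ => hmeet z h₀ h₁, h⟩
    · rcases h with h | h
      · exact Or.inr ⟨M, inferInstance, inferInstance, inferInstance, j₀, z₀, hmeet, h⟩
      · exact Or.inl ⟨M, inferInstance, inferInstance, inferInstance, j₁, z₀, fun z h₁ h₀ => hmeet z h₀ h₁, h⟩
    · exact absurd rfl hii'

end Rank

/-! ### §3 Realisations -/

section Hodge

variable {Φ : ∀ i, CMType (K i)} {A : I → AbelianVariety ℂ} {ιA : ∀ i, 𝓞 (K i) →+* End (A i)}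
  {θ : ∀ i, K i →+* Module.End ℂ (complexBetti (A i).X 1)}

/-- **EVERY HODGE CLASS ON EVERY `A₀^a × A₁^b` IS A SUM OF PRODUCTS ⟺ ONE TYPE IS EQUIDISTRIBUTED OVER `M`** (abelian pivot
with irreducible odd part, closures meeting inside `M`). [cite: MoonenZarhin1999LowDim, §3 (3.1)]
[cite: Gordon1999HodgeAVSurvey, 7.5–7.7 and 9.4.3] -/
theorem forall_hodgeClassesProductSpan_pair_iff_of_irreducible_anti [IsAbelianGalois ℚ M] {i₀ i₁ : I} (h01 : i₀ ≠ i₁)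
    (hI : ∀ l, l = i₀ ∨ l = i₁) (j₀ : M →+* K i₀) (j₁ : M →+* K i₁) (z₀ : M →+* ℂ)
    (hmeet : ∀ z : ℂ, z ∈ normalClosure ℚ (K i₀) ℂ → z ∈ normalClosure ℚ (K i₁) ℂ → z ∈ Set.range z₀)
    (hirr : ∀ W : Submodule ℚ ((M →+* ℂ) → ℚ), W ≤ antiWeights (E := M →+* ℂ) (starRingAut : ℂ ≃+* ℂ) → W ≠ ⊥ →
      (∀ (g : ℂ ≃+* ℂ) (f : (M →+* ℂ) → ℚ), f ∈ W → (fun z => f (g • z)) ∈ W) →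
      W = antiWeights (E := M →+* ℂ) (starRingAut : ℂ ≃+* ℂ))
    (hA : ∀ i, IsCMTypeRealisation (Φ i) (A i) (ιA i) (θ i)) :
    (∀ (N₁ N₂ : ℕ) [NeZero N₁] [NeZero N₂] (π₁ : Fin N₁ → I) (π₂ : Fin N₂ → I), (∀ l₁ l₂, π₁ l₁ ≠ π₂ l₂) →
        HodgeClassesProductSpan (⨁ fun l => A (π₁ l)) (⨁ fun l => A (π₂ l))) ↔
      ((∀ z : M →+* ℂ, 2 * (Finset.univ.filter fun t : K i₀ →+* ℂ => t.comp j₀ = z ∧ t ∈ (Φ i₀).1).card =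
          (Finset.univ.filter fun t : K i₀ →+* ℂ => t.comp j₀ = z).card) ∨
        ∀ z : M →+* ℂ, 2 * (Finset.univ.filter fun t : K i₁ →+* ℂ => t.comp j₁ = z ∧ t ∈ (Φ i₁).1).card =
          (Finset.univ.filter fun t : K i₁ →+* ℂ => t.comp j₁ = z).card) := by
  haveI : Nonempty I := ⟨i₀⟩
  exact (cmFamilyRank_add_card_eq_iff_forall_hodgeClassesProductSpan hA).symm.trans
    (cmFamilyRank_add_card_eq_pair_iff_of_irreducible_anti h01 hI Φ j₀ j₁ z₀ hmeet hirr)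

/-- **Both types NOT equidistributed ⟹ a MIXED exceptional Hodge class** on some `(⨁_l A_{π₁ l}) × (⨁_l A_{π₂ l})` with
disjoint slot maps (abelian pivot with irreducible odd part; no hypothesis on the closures).
[cite: MoonenZarhin1999LowDim, Thm. (0.1) (a)] [cite: Gordon1999HodgeAVSurvey, 7.5 and 9.4.3] -/
theorem exists_not_hodgeClassesProductSpan_pair_of_shadows_ne_zero [IsAbelianGalois ℚ M] {i₀ i₁ : I} (h01 : i₀ ≠ i₁)
    (j₀ : M →+* K i₀) (j₁ : M →+* K i₁)
    (hirr : ∀ W : Submodule ℚ ((M →+* ℂ) → ℚ), W ≤ antiWeights (E := M →+* ℂ) (starRingAut : ℂ ≃+* ℂ) → W ≠ ⊥ →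
      (∀ (g : ℂ ≃+* ℂ) (f : (M →+* ℂ) → ℚ), f ∈ W → (fun z => f (g • z)) ∈ W) →
      W = antiWeights (E := M →+* ℂ) (starRingAut : ℂ ≃+* ℂ))
    (hA : ∀ i, IsCMTypeRealisation (Φ i) (A i) (ιA i) (θ i))
    (h₀ : ∃ z : M →+* ℂ, 2 * (Finset.univ.filter fun t : K i₀ →+* ℂ => t.comp j₀ = z ∧ t ∈ (Φ i₀).1).card ≠
      (Finset.univ.filter fun t : K i₀ →+* ℂ => t.comp j₀ = z).card)
    (h₁ : ∃ z : M →+* ℂ, 2 * (Finset.univ.filter fun t : K i₁ →+* ℂ => t.comp j₁ = z ∧ t ∈ (Φ i₁).1).card ≠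
      (Finset.univ.filter fun t : K i₁ →+* ℂ => t.comp j₁ = z).card) :
    ∃ (N₁ N₂ : ℕ) (_ : NeZero N₁) (_ : NeZero N₂) (π₁ : Fin N₁ → I) (π₂ : Fin N₂ → I),
      (∀ l₁ l₂, π₁ l₁ ≠ π₂ l₂) ∧ ¬ HodgeClassesProductSpan (⨁ fun l => A (π₁ l)) (⨁ fun l => A (π₂ l)) := by
  haveI : Nonempty I := ⟨i₀⟩
  exact exists_not_hodgeClassesProductSpan_of_cmFamilyRank_add_card_ne hA
    (ne_of_lt (cmFamilyRank_add_card_lt_of_shadows_ne_zero_of_irreducible_anti h01 Φ j₀ j₁ hirr h₀ h₁))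

end Hodge

end Summit.HodgeConjecture.CorCM

end
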